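import Summits.BirchSwinnertonDyer.BirchSwinnertonDyer.Theses.LeadingTerm
import Literature.NumberTheory.EllipticCurves.IwasawaSelmerDualProofs
import Literature.NumberTheory.EllipticCurves.IwasawaGeneratorChangeProofs
import Mathlib.Algebra.Module.CharacterModule

/-!
# BirchSwinnertonDyer / LeadingTerm — crux `PinchPrime` (stmt-BirchSwinnertonDyer-16218),
# line `SketchIdeator2`, stub `stub_leverTrivial` (GLUE: the lever, algebraic half)

Registered stub of the lead skeleton `Cruxes/PinchPrime` (line `SketchIdeator2`, card
`first-layer-stability-sharp-pinch`). For an elliptic curve `E/ℚ` (globally minimal `W`), a prime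
`p`, a `ℤ_p`-extension datum `κ` with element `γ`, and an Iwasawa datum
`D : W.SelmerDualData κ γ` (the Pontryagin dual `X = X(E/ℚ_∞) = Hom(Sel_{p^∞}(E/ℚ_∞), ℚ/ℤ)` as an
abstract `Λ = ℤ_p⟦T⟧`-module, `T` acting as `conj_γ - 1`, file `IwasawaSelmer` part (d)) with `X`
finitely generated: **if every class of `Sel_{p^∞}(E/ℚ_∞)` fixed by `conj_γ^p` is fixed by
`conj_γ` ("stability one layer up"), then `T · X = 0`.**

Proof (pure algebra on the hypothesis structure, no unproved facts):

* *Duality* (`X_smul_top_le_omega_smul_top`). Put `ψ = conj_γ - 1`, `ψ_p = conj_γ^p - 1` on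
  `S = Sel_∞` and `ω₁ = (1+T)^p - 1 ∈ Λ`; iterating the axiom `toDual_T_smul` gives
  `((1+T)^n y)(s) = y(conj_γ^n s)` (`toDual_one_add_X_pow_smul`), so `(ω₁ y)(s) = y(ψ_p s)` and
  `(T x)(s) = x(ψ s)`. Stability says `ker ψ_p ≤ ker ψ`, so for `x ∈ X` the character `x ∘ ψ`
  factors through `ψ_p(S) ≅ S / ker ψ_p` (`AddMonoidHom.liftOfSurjective`) and extends from the
  subgroup `ψ_p(S) ≤ S` to a character `y*` of `S` because `ℚ/ℤ` is divisible, hence an injective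
  `ℤ`-module (Baer, Mathlib `Module.Baer.of_divisible`, `extension_property_addMonoidHom`):
  `y* ∘ ψ_p = x ∘ ψ`. With `y = toDual⁻¹ y*` this reads `ω₁ y = T x`. Hence `T·X ⊆ ω₁·X`.
* *Nakayama* (`X_smul_eq_bot_of_le_omega_smul`). `ω₁ = ν·T` with `ν = ∑_{i<p} (1+T)^i`,
  `ν(0) = p ∈ 𝔪_{ℤ_p}`, so `ν ∈ 𝔪_Λ = Jac(Λ)` and `N = T·X ⊆ ν·N` with `N` finitely generated
  forces `N = 0` (`Submodule.eq_bot_of_le_smul_of_le_jacobson_bot`).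

Sources: Greenberg, *Iwasawa theory for elliptic curves*, LNM 1716 (1999), §1 (p. 60, the
`Λ`-module structure of the Pontryagin dual); Washington, *Introduction to Cyclotomic Fields*,
§13.2, Lemma 13.16 (Nakayama for `Λ`-modules); Mazur, Invent. Math. 18 (1972), §6.
-/

noncomputable section

set_option linter.dupNamespace false

namespace Summit.BirchSwinnertonDyer.BirchSwinnertonDyer.Cruxes.PinchPrime.FirstLayerStability

open scoped MatrixGroups ModularForm
open CongruenceSubgroup Literature.NumberTheory.EllipticCurves
  Literature.NumberTheory.EllipticCurves.ModularForms
open Summit.BirchSwinnertonDyer.BirchSwinnertonDyer.Theses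

/-! ## The Nakayama step -/

/-- **Nakayama step of the lever.** For a finitely generated `Λ`-module `M` (`Λ = ℤ_p⟦T⟧`):
`T·M ⊆ ((1+T)^p − 1)·M ⟹ T·M = 0`. Indeed `(1+T)^p − 1 = ν·T` with `ν = ∑_{i<p} (1+T)^i`
(`geom_sum_mul`), `ν(0) = p` is a non-unit of `ℤ_p`, so `ν ∈ 𝔪_Λ = Jac(Λ)`, and
`N := T·M ⊆ ν·N` forces `N = 0` (`Submodule.eq_bot_of_le_smul_of_le_jacobson_bot`).
Washington, *Introduction to Cyclotomic Fields*, §13.2 (Nakayama's lemma for `Λ`-modules,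
Lemma 13.16). -/
theorem X_smul_eq_bot_of_le_omega_smul {p : ℕ} [Fact p.Prime] (M : Type*) [AddCommGroup M]
    [Module (IwasawaAlgebra p) M] [Module.Finite (IwasawaAlgebra p) M]
    (h : (Ideal.span {(PowerSeries.X : IwasawaAlgebra p)}) • (⊤ : Submodule (IwasawaAlgebra p) M)
        ≤ (Ideal.span {((1 + PowerSeries.X : IwasawaAlgebra p) ^ p - 1)}) • ⊤) :
    (Ideal.span {(PowerSeries.X : IwasawaAlgebra p)}) • (⊤ : Submodule (IwasawaAlgebra p) M)
      = ⊥ := by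
  set N := (Ideal.span {(PowerSeries.X : IwasawaAlgebra p)}) • (⊤ : Submodule (IwasawaAlgebra p) M)
    with hN
  set ν : IwasawaAlgebra p := ∑ i ∈ Finset.range p, (1 + PowerSeries.X) ^ i with hν
  have hω : ((1 + PowerSeries.X : IwasawaAlgebra p) ^ p - 1) = ν * PowerSeries.X := by
    have := geom_sum_mul (1 + PowerSeries.X : IwasawaAlgebra p) p
    rw [add_sub_cancel_left] at this
    exact this.symm
  have hle : N ≤ (Ideal.span {ν}) • N := by
    calc N ≤ (Ideal.span {((1 + PowerSeries.X : IwasawaAlgebra p) ^ p - 1)}) • ⊤ := h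
      _ = (Ideal.span {ν} * Ideal.span {(PowerSeries.X : IwasawaAlgebra p)}) •
            (⊤ : Submodule (IwasawaAlgebra p) M) := by
          rw [hω, Ideal.span_singleton_mul_span_singleton]
      _ = (Ideal.span {ν}) • N := by rw [hN, Submodule.mul_smul]
  have hνmax : ν ∈ IsLocalRing.maximalIdeal (IwasawaAlgebra p) := by
    rw [IsLocalRing.mem_maximalIdeal, mem_nonunits_iff, PowerSeries.isUnit_iff_constantCoeff]
    have hc : PowerSeries.constantCoeff ν = (p : ℤ_[p]) := by
      simp [hν, map_sum]
    rw [hc]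
    exact PadicInt.p_nonunit
  have hjac : Ideal.span {ν} ≤ (⊥ : Ideal (IwasawaAlgebra p)).jacobson := by
    rw [IsLocalRing.jacobson_eq_maximalIdeal ⊥ bot_ne_top, Ideal.span_le, Set.singleton_subset_iff]
    exact hνmax
  have hfg : N.FG := IsNoetherian.noetherian N
  exact Submodule.eq_bot_of_le_smul_of_le_jacobson_bot (Ideal.span {ν}) N hfg hle hjac

/-! ## The duality step (axiomatic Pontryagin duality, `ℚ/ℤ` injective) -/

section Duality

variable {p : ℕ} [Fact p.Prime] {S : Type*} [AddCommGroup S] (φ : AddMonoid.End S)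
  {M : Type*} [AddCommGroup M] [Module (IwasawaAlgebra p) M]
  (toDual : M →+ (S →+ AddCircle (1 : ℚ)))

/-- **`((1+T)^n · x)(s) = x(φ^n s)`** for a `Λ`-module `M` in duality `toDual : M → Hom(S, ℚ/ℤ)`
with an abelian group `S` on which `T` acts as `φ - 1` (`hT`, the axiom `toDual_T_smul` of
`SelmerDualData` abstracted): induction on `n`, `(1+T)·x = x + T·x`. Greenberg, LNM 1716 (1999),
§1 p. 60. -/
theorem toDual_one_add_X_pow_smul
    (hT : ∀ (x : M) (s : S),
      toDual ((PowerSeries.X : IwasawaAlgebra p) • x) s = toDual x (φ s) - toDual x s)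
    (n : ℕ) :
    ∀ (x : M) (s : S),
      toDual (((1 + PowerSeries.X : IwasawaAlgebra p) ^ n) • x) s = toDual x ((φ ^ n) s) := by
  induction n with
  | zero => intro x s; rw [pow_zero, one_smul, pow_zero, AddMonoid.End.one_apply]
  | succ n ih =>
    intro x s
    rw [pow_succ, mul_smul, ih, add_smul, one_smul, map_add, AddMonoidHom.add_apply, hT,
      add_sub_cancel, pow_succ', AddMonoid.End.coe_mul, Function.comp_apply]

/-- **`(((1+T)^p - 1) · x)(s) = x(φ^p s) - x(s)`**, i.e. `ω₁ = (1+T)^p - 1` acts as `φ^p - 1`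
(from `toDual_one_add_X_pow_smul`). Greenberg, LNM 1716 (1999), §1 p. 60. -/
theorem toDual_omega_smul
    (hT : ∀ (x : M) (s : S),
      toDual ((PowerSeries.X : IwasawaAlgebra p) • x) s = toDual x (φ s) - toDual x s)
    (x : M) (s : S) :
    toDual (((1 + PowerSeries.X : IwasawaAlgebra p) ^ p - 1) • x) s =
      toDual x ((φ ^ p) s) - toDual x s := by
  rw [sub_smul, one_smul, map_sub, AddMonoidHom.sub_apply, toDual_one_add_X_pow_smul φ toDual hT]

/-- **Stability one layer up forces `T·M ⊆ ((1+T)^p - 1)·M`.** Let `toDual : M ≃ Hom(S, ℚ/ℤ)` be a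
group isomorphism under which `T` acts as `φ - 1`, and assume `φ^p s = s → φ s = s` on `S`. For
`x ∈ M` the character `x ∘ (φ - 1) = toDual (T x)` kills `ker (φ^p - 1)`, so it factors through
the image `(φ^p - 1)(S)` (`AddMonoidHom.liftOfSurjective`) and extends to a character `y*` of `S`
(`ℚ/ℤ` is divisible, hence `ℤ`-injective: Mathlib `Module.Baer.of_divisible`,
`Module.Baer.extension_property_addMonoidHom`) with `y* ∘ (φ^p - 1) = x ∘ (φ - 1)`; for
`y = toDual⁻¹ y*` this says `((1+T)^p - 1) y = T x` (`toDual_omega_smul`, injectivity).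
Greenberg, LNM 1716 (1999), §1 p. 60; Mazur, Invent. Math. 18 (1972), §6. -/
theorem X_smul_top_le_omega_smul_top (hbij : Function.Bijective toDual)
    (hT : ∀ (x : M) (s : S),
      toDual ((PowerSeries.X : IwasawaAlgebra p) • x) s = toDual x (φ s) - toDual x s)
    (hstab : ∀ s : S, (φ ^ p) s = s → φ s = s) :
    (Ideal.span {(PowerSeries.X : IwasawaAlgebra p)}) • (⊤ : Submodule (IwasawaAlgebra p) M)
      ≤ (Ideal.span {((1 + PowerSeries.X : IwasawaAlgebra p) ^ p - 1)}) • ⊤ := by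
  -- every `T x` is an `ω₁ y`
  have key : ∀ x : M, ∃ y : M,
      ((1 + PowerSeries.X : IwasawaAlgebra p) ^ p - 1) • y =
        (PowerSeries.X : IwasawaAlgebra p) • x := by
    intro x
    -- `δ = φ^p - 1 : S → S`, with kernel contained in the kernel of `toDual (T x) = x ∘ (φ - 1)`
    let δ : S →+ S := (φ ^ p - 1 : AddMonoid.End S)
    have hδ : ∀ s, δ s = (φ ^ p) s - s := fun s ↦ rfl
    have hker : δ.rangeRestrict.ker ≤ (toDual ((PowerSeries.X : IwasawaAlgebra p) • x)).ker := by
      intro s hs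
      rw [AddMonoidHom.mem_ker] at hs ⊢
      have hs' : δ s = 0 := congrArg (fun z : δ.range ↦ (z : S)) hs
      rw [hδ, sub_eq_zero] at hs'
      rw [hT, hstab s hs', sub_self]
    have hsurj : Function.Surjective δ.rangeRestrict := AddMonoidHom.rangeRestrict_surjective δ
    -- the factorisation through `δ(S)` …
    let χ : δ.range →+ AddCircle (1 : ℚ) :=
      δ.rangeRestrict.liftOfSurjective hsurj ⟨toDual ((PowerSeries.X : IwasawaAlgebra p) • x), hker⟩
    have hχ : ∀ s, χ (δ.rangeRestrict s) = toDual ((PowerSeries.X : IwasawaAlgebra p) • x) s :=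
      fun s ↦ AddMonoidHom.liftOfRightInverse_comp_apply _ _ _ _ s
    -- … and its extension to `S` (injectivity of `ℚ/ℤ`)
    obtain ⟨ystar, hystar⟩ :=
      (Module.Baer.of_divisible (AddCircle (1 : ℚ))).extension_property_addMonoidHom
        δ.range.subtype δ.range.subtype_injective χ
    have hy' : ∀ s, ystar ((φ ^ p) s) - ystar s =
        toDual ((PowerSeries.X : IwasawaAlgebra p) • x) s := by
      intro s
      rw [← map_sub, ← hχ s, ← hystar]
      rfl
    obtain ⟨y, hy⟩ := hbij.2 ystar
    refine ⟨y, hbij.1 ?_⟩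
    ext s
    rw [toDual_omega_smul φ toDual hT, hy, hy']
  rw [Submodule.smul_le]
  intro r hr n _
  obtain ⟨c, rfl⟩ := Ideal.mem_span_singleton'.1 hr
  obtain ⟨y, hy⟩ := key n
  rw [mul_smul, ← hy, ← mul_smul]
  exact Submodule.smul_mem_smul (Ideal.mul_mem_left _ c (Ideal.mem_span_singleton_self _))
    Submodule.mem_top

end Duality

/-! ## The stub -/

/-- **The lever, algebraic half** (stub `stub_leverTrivial` of crux `PinchPrime`, line
`SketchIdeator2`): for an elliptic curve `E/ℚ` (globally minimal `W`), a prime `p`, a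
`ℤ_p`-extension datum `κ` with element `γ`, and a finitely generated Iwasawa datum
`D : W.SelmerDualData κ γ` (`X = D.X = Hom(Sel_{p^∞}(E/ℚ_∞), ℚ/ℤ)`, `T = conj_γ - 1`), if every
class of `Sel_{p^∞}(E/ℚ_∞)` fixed by `conj_γ^p` is fixed by `conj_γ`, then `T · X = 0`:
stability gives `T·X ⊆ ((1+T)^p - 1)·X` by Pontryagin duality (`X_smul_top_le_omega_smul_top`,
`ℚ/ℤ` injective), and `(1+T)^p - 1 ∈ 𝔪_Λ · T` with Nakayama gives `T·X = 0`
(`X_smul_eq_bot_of_le_omega_smul`). The hypotheses `κ.IsCyclotomic`, `κ.IsTopGenerator γ` are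
not used. Greenberg, LNM 1716 (1999), §1 p. 60; Washington, *Introduction to Cyclotomic Fields*,
Lemma 13.16. -/
theorem stub_leverTrivial :
    ∀ (W : WeierstrassCurve ℚ) [W.IsElliptic] [W.IsGloballyMinimal] (p : ℕ) [Fact p.Prime]
      (κ : ZpExtension ℚ p) (γ : Field.absoluteGaloisGroup ℚ),
      κ.IsCyclotomic → κ.IsTopGenerator γ →
      (∀ s : W.selmerInfty κ, ((W.conjSelmerInfty κ γ) ^ p) s = s → W.conjSelmerInfty κ γ s = s) →
      ∀ (D : W.SelmerDualData κ γ) [Module.Finite (IwasawaAlgebra p) D.X],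
        (Ideal.span {(PowerSeries.X : IwasawaAlgebra p)}) • (⊤ : Submodule (IwasawaAlgebra p) D.X)
          = ⊥ := by
  intro W _ _ p _ κ γ _ _ hstab D _
  refine X_smul_eq_bot_of_le_omega_smul D.X
    (X_smul_top_le_omega_smul_top (W.conjSelmerInfty κ γ) D.toDual D.bijective (fun x s ↦ ?_)
      hstab)
  rw [D.toDual_T_smul]
  rfl

end Summit.BirchSwinnertonDyer.BirchSwinnertonDyer.Cruxes.PinchPrime.FirstLayerStability

end
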